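import Summits.NavierStokesRegularity.NavierStokesRegularity.Theses.PumpContinuation
import Summits.NavierStokesRegularity.NavierStokesRegularity.Theorems.EulerTypeIGlue.Negative.WithoutLerayHopfFalse
import Literature.Analysis.FluidPDE.TaoAveragedSobolevProofs

/-!
# Crux `EulerProximatePump` (stmt-NavierStokesRegularity-18302), negative side — line `SketchIdeator2`:
# finite energy and maximality are load-bearing in the stub `stub_classicalTypeIToMild`

Negative-side support lemma of the crux disprover (cdisprove, cycle 1, 2026-08-17) about a registered
stub of the lead's picked line (`Cruxes/EulerProximatePump/Lines/SketchIdeator2.lean`):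

`stub_classicalTypeIToMild : ∀ ν > 0, ∀ T > 0, ∀ u p, IsMaximalSmoothSolution ν 0 u p T →
IsLerayHopfOn T ν 0 (u 0) u → HasRapidSpatialDecay (u 0) → IsTypeIBlowup u T → ∃ M, tIB[B, M]`
(classical maximal Type-I blow-up ⇒ Schwartz-data `H¹⁰_df`-mild Type-I blow-up of the Navier–Stokes
form `B` with no mild extension; the conclusion does not mention `u`).

* `classicalTypeIToMild_withoutLerayHopf_iff_nsTypeI` — with the hypothesis `IsLerayHopfOn` DELETED
  the stub is EQUIVALENT to its own conclusion `∃ M, tIB[B, M]`, i.e. to a Type-I Millennium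
  counterexample in Tao's mild formulation: the remaining hypotheses are inhabited by the parasitic
  pressure-driven drift of Koch–Nadirashvili–Seregin–Šverák (Acta Math. 203 (2009), §1 p. 3),
  `u = ((1-t)^{-1/2} - 1)e₀`, `p = -½(1-t)^{-3/2}x₀` — classical on `[0,1) × ℝ³` for every
  viscosity, Schwartz datum `0`, Type-I with constant `1`, no classical continuation (the landed
  `RungReynoldsOne/Negative` + `EulerTypeIGlue/Negative` drift lemmas). So the lead's "provable now"
  is correct ONLY through finite energy (weak–strong uniqueness / Leray–Hopf energy bounds, as in the
  proved `EulerTypeIGlue` front end); a proof transparent to `IsLerayHopfOn` would be a proof of NSTypeI.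
* `classicalTypeIToMild_withoutMaximality_iff_nsTypeI` — likewise MAXIMALITY is load-bearing: with
  `IsMaximalSmoothSolution` weakened to `IsClassicalNSSolutionOn (Ico 0 T)` the stub is again equivalent
  to NSTypeI (the rest state `u ≡ 0`, `p ≡ 0` inhabits the rest; `IsTypeIBlowup` alone does not make
  `T` singular).
* Remark (checked in the crux work file `Cruxes/EulerProximatePump/Disproof.lean`, § Targets): by the
  landed obstruction `DoorObstructions.not_nsTypeIBlowup_of_not_eulerProximatePump`, any DISPROOF of the
  crux refutes both weakened stubs outright.

Nothing here closes the item (`--supports`); no conclusion asserts a Theses decl positively.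

## References

* G. Koch, N. Nadirashvili, G. Seregin, V. Šverák, Acta Math. 203 (2009), arXiv:0709.3599, §1 p. 3.
  [`KochNadirashviliSereginSverak2009`]
* T. Tao, J. Amer. Math. Soc. 29 (2016), arXiv:1402.0290v3, §1.1 (1.5), (1.15). [`Tao2016AveragedNS`]
-/

noncomputable section

-- the nested summit namespace `…NavierStokesRegularity.NavierStokesRegularity…` is the tree's layout
-- (D-0017), so the duplicated-namespace linter must be silenced for every declaration below
set_option linter.dupNamespace false

namespace Summit.NavierStokesRegularity.NavierStokesRegularity.Theorems.EulerProximatePump.Negative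

open MeasureTheory Set Filter Topology
open scoped ENNReal SchwartzMap
open Literature.Analysis.FluidPDE Literature.Analysis.FluidPDE.Tao2016
open Summit.NavierStokesRegularity.NavierStokesRegularity.Theses.PumpContinuation
open Summit.NavierStokesRegularity.NavierStokesRegularity.Theorems.RungReynoldsOneNegative
  (drift driftP drift_isClassical drift_rapidDecay drift_not_hasSmoothExtensionPast gI gI_zero
    gI_contDiffOn tendsto_abs_gI_atTop)
open Summit.NavierStokesRegularity.NavierStokesRegularity.Theorems.EulerTypeIGlue.Negative
  (isTypeIBlowup_driftI)

/-- Schwartz-data `H¹⁰_df`-mild Type-I blow-up of the form `T` at ceiling `M` with no mild extension —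
verbatim the matrix of the crux and of the stub's conclusion. -/
local notation3 "tIB[" T ", " M "]" =>
  ∃ u₀ : SchwartzMap (EuclideanSpace ℝ (Fin 3)) (EuclideanSpace ℝ (Fin 3)),
    Literature.Analysis.FluidPDE.VectorCalculus.IsDivFree ⇑u₀ ∧ ∃ S : ℝ, 0 < S ∧
    ∃ u : ℝ → Literature.Analysis.FluidPDE.Tao2016.L2C,
      Literature.Analysis.FluidPDE.Tao2016.IsMildSolutionFor T
        (Literature.Analysis.FluidPDE.Tao2016.schwartzL2 u₀) (Set.Ico 0 S) u ∧
      (∀ t ∈ Set.Ico 0 S, MeasureTheory.eLpNorm (u t) ⊤ MeasureTheory.volume ≤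
        ENNReal.ofReal (M / Real.sqrt (S - t))) ∧
      ¬ ∃ S' : ℝ, S < S' ∧ ∃ v : ℝ → Literature.Analysis.FluidPDE.Tao2016.L2C,
        Literature.Analysis.FluidPDE.Tao2016.IsMildSolutionFor T
          (Literature.Analysis.FluidPDE.Tao2016.schwartzL2 u₀) (Set.Ico 0 S') v ∧
        ∀ t ∈ Set.Ico 0 S, v t = u t

/-- **The KNSS drift inhabits the Leray–Hopf-free hypotheses of `stub_classicalTypeIToMild`** at
`ν = T = 1`: maximal smooth (classical on `[0,1)`, no classical continuation), rapidly decaying datum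
`0`, Type-I. [cite: KochNadirashviliSereginSverak2009, §1 p. 3] -/
theorem driftI_inhabits_hypotheses_withoutLerayHopf :
    IsMaximalSmoothSolution 1 0 (drift (gI 1)) (driftP (gI 1)) 1 ∧
      HasRapidSpatialDecay (drift (gI 1) 0) ∧ IsTypeIBlowup (drift (gI 1)) 1 :=
  ⟨⟨drift_isClassical (gI_contDiffOn 1) 1, drift_not_hasSmoothExtensionPast (tendsto_abs_gI_atTop 1 one_pos) 1⟩,
    drift_rapidDecay (gI_zero 1), isTypeIBlowup_driftI zero_le_one⟩

/-- **`IsLerayHopfOn` is load-bearing in `stub_classicalTypeIToMild`**: with it deleted, the stub is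
EQUIVALENT to its conclusion — a Schwartz-data `H¹⁰_df`-mild Type-I blow-up of the Navier–Stokes
form with no mild extension (NSTypeI). (`→`: feed the KNSS drift; `←`: the conclusion ignores the
hypotheses.) [folklore] -/
theorem classicalTypeIToMild_withoutLerayHopf_iff_nsTypeI :
    (∀ ν : ℝ, 0 < ν → ∀ T : ℝ, 0 < T →
      ∀ (u : ℝ → EuclideanSpace ℝ (Fin 3) → EuclideanSpace ℝ (Fin 3))
        (p : ℝ → EuclideanSpace ℝ (Fin 3) → ℝ),
      IsMaximalSmoothSolution ν 0 u p T → HasRapidSpatialDecay (u 0) → IsTypeIBlowup u T →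
      ∃ M : ℝ, tIB[eulerForm, M]) ↔
    ∃ M : ℝ, tIB[eulerForm, M] := by
  refine ⟨fun h => ?_, fun h _ _ _ _ _ _ _ _ _ => h⟩
  obtain ⟨hmax, hdec, hI⟩ := driftI_inhabits_hypotheses_withoutLerayHopf
  exact h 1 one_pos 1 one_pos _ _ hmax hdec hI

/-! ### Maximality is load-bearing too (the rest state) -/

/-- The zero field decays rapidly with all derivatives. [folklore] -/
theorem hasRapidSpatialDecay_zero :
    HasRapidSpatialDecay (0 : EuclideanSpace ℝ (Fin 3) → EuclideanSpace ℝ (Fin 3)) := by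
  intro n K
  refine ⟨0, fun x => ?_⟩
  simp

/-- The rest state obeys every Type-I bound (the predicate does not ask `T` to be singular). [folklore] -/
theorem isTypeIBlowup_zero (T : ℝ) :
    IsTypeIBlowup (0 : ℝ → EuclideanSpace ℝ (Fin 3) → EuclideanSpace ℝ (Fin 3)) T :=
  ⟨0, Eventually.of_forall fun t x => by simp⟩

/-- **The rest state inhabits the maximality-free hypotheses of `stub_classicalTypeIToMild`**
(`IsMaximalSmoothSolution` weakened to `IsClassicalNSSolutionOn (Ico 0 T)`), at `ν = T = 1`. [folklore] -/
theorem restState_inhabits_hypotheses_withoutMaximality :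
    IsClassicalNSSolutionOn (Ico 0 1) 1 0 (0 : ℝ → EuclideanSpace ℝ (Fin 3) → EuclideanSpace ℝ (Fin 3)) 0 ∧
      IsLerayHopfOn 1 1 0 ((0 : ℝ → EuclideanSpace ℝ (Fin 3) → EuclideanSpace ℝ (Fin 3)) 0) 0 ∧
      HasRapidSpatialDecay ((0 : ℝ → EuclideanSpace ℝ (Fin 3) → EuclideanSpace ℝ (Fin 3)) 0) ∧
      IsTypeIBlowup (0 : ℝ → EuclideanSpace ℝ (Fin 3) → EuclideanSpace ℝ (Fin 3)) 1 :=
  ⟨isClassicalNSSolutionOn_zero _ _, isLerayHopfOn_zero 1 1, hasRapidSpatialDecay_zero, isTypeIBlowup_zero 1⟩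

/-- **Maximality (`¬ HasSmoothExtensionPast`) is load-bearing in `stub_classicalTypeIToMild`**: with
`IsMaximalSmoothSolution ν 0 u p T` weakened to `IsClassicalNSSolutionOn (Ico 0 T) ν 0 u p` the stub is
again EQUIVALENT to NSTypeI (the rest state inhabits the remaining hypotheses; `IsTypeIBlowup` alone does
not make `T` singular). [folklore] -/
theorem classicalTypeIToMild_withoutMaximality_iff_nsTypeI :
    (∀ ν : ℝ, 0 < ν → ∀ T : ℝ, 0 < T →
      ∀ (u : ℝ → EuclideanSpace ℝ (Fin 3) → EuclideanSpace ℝ (Fin 3))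
        (p : ℝ → EuclideanSpace ℝ (Fin 3) → ℝ),
      IsClassicalNSSolutionOn (Ico 0 T) ν 0 u p → IsLerayHopfOn T ν 0 (u 0) u →
      HasRapidSpatialDecay (u 0) → IsTypeIBlowup u T → ∃ M : ℝ, tIB[eulerForm, M]) ↔
    ∃ M : ℝ, tIB[eulerForm, M] := by
  refine ⟨fun h => ?_, fun h _ _ _ _ _ _ _ _ _ _ => h⟩
  obtain ⟨hcl, hLH, hdec, hI⟩ := restState_inhabits_hypotheses_withoutMaximality
  exact h 1 one_pos 1 one_pos _ _ hcl hLH hdec hI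


end Summit.NavierStokesRegularity.NavierStokesRegularity.Theorems.EulerProximatePump.Negative

end
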